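import Literature.AlgebraicGeometry.Motives.ProjectiveSpaceFormDivisors
import Literature.AlgebraicGeometry.Motives.CartierDivisorProperIntersection
import Literature.AlgebraicGeometry.Motives.ProjectiveSpaceHyperplaneSection
import HarnessLib

/-!
# Hyperplane sections of linear subspaces of `ℙᴺ` have multiplicity one (Fulton, Example 2.5.1)

Fulton, *Intersection Theory* (2nd ed. 1998), Example 2.5.1: "If `Lᵏ` is a `k`-dimensional linear
subspace of `ℙⁿ`, then `c₁(𝒪(1)) ∩ [Lᵏ] = [Lᵏ⁻¹]`", and §2.1 / §1.2 for the Weil divisor of a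
Cartier divisor, `[D] = Σ ord_V(D) [V]` with `ord_V(r) = ℓ_A(A/(r))`. The tree realises `c₁(𝒪(1)) ∩ -`
on `CH_*(ℙ^d_K)` by intersecting with hyperplanes `V₊(ℓ)` (`ProjSpace.formDivisor`,
`Motives/ProjectiveSpaceFormDivisors`; `ProjSpace.hyperplaneSection`,
`Motives/ProjectiveSpaceHyperplaneSection`) and knows that a hyperplane section of an `r`-plane is
`a • [(r-1)-plane]` with `a ≥ 1` (`ProjSpace.exists_primeInter_formDivisor_eq_smul_of_isLinearSubspacePoint`,
`Motives/ProjectiveSpaceLinearSubspaceSection`). This file computes the local multiplicities and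
shows **`a = 1`**:

* `ProjSpace.primeIdealOf_eq_span_sec` — in the chart `D₊(x_l) = Spec (K[x]_{(x_l)})₀`, the prime
  of a point whose homogeneous prime is generated by linear forms `L₁, …, L_t` is generated by the
  sections `L₁/x_l, …, L_t/x_l` (degree-`e` members of `(L₁, …, L_t)` are `Σ Hⱼ Lⱼ` with `Hⱼ` forms
  of degree `e - 1`, `exists_eq_sum_mul_of_mem_span_of_isHomogeneous`); hence the germs generate
  the maximal ideal of `𝒪_{ℙ,y}` (`maximalIdeal_stalk_eq_span`, Mathlib
  `IsAffineOpen.isLocalization_stalk`);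
* `ProjSpace.ord_formToFunctionField_eq_one` — **`ord_{V₊(ℓ)}(ℓ/x_l) = 1`** at the generic point
  of a hyperplane, and `ProjSpace.cycle_formDivisor_eq_primeCycle` — **the Weil divisor of `V₊(ℓ)`
  is the prime cycle of its generic point** (`[V₊(ℓ)] = 1 · [η_ℓ]`);
* `ProjSpace.ord_quotient_germ_eq_one` — for linear-subspace points `w ⤳ w'` cut out by `(L)` and
  `(L, ℓ)`, the order of `ℓ/x_l` in `𝒪_{ℙ,w'}/𝔭_w` (the local ring of `closure {w}` at `w'`) is `1`
  (`𝔭_w + (ℓ/x_l) = 𝔪_{w'}`);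
* `ProjSpace.exists_primeInter_formDivisor_eq_primeCycle_of_isLinearSubspacePoint` —
  **`V₊(ℓ) · [closure {w}] = [closure {w'}]`** on the nose for an `r`-plane point `w`, `ℓ ∉ 𝔭_w`
  (through the coefficient formula `CartierDivisor.ordAt_pullbackAvoiding_ofPoint_eq_toNat_ord_quotient`
  of `Motives/CartierDivisorProperIntersection`, Fulton Thm. 2.4 Case 1);
* `ProjSpace.exists_hyperplaneSection_mk_primeCycle_eq` — **`c₁(𝒪(1)) ∩ [Lⁿ⁺¹] = [Lⁿ]` in
  `CH_n(ℙᴺ_K)`** (`K` infinite), Example 2.5.1 as printed.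

Everything is proved; no named facts.

## References

* W. Fulton, *Intersection Theory*, 2nd ed., Springer (1998): Example 2.5.1 (p. 41), §2.1 (p. 29),
  §1.2 (p. 8), Thm. 2.4 (p. 35). [Fulton1998]
* R. Hartshorne, *Algebraic Geometry*, GTM 52, Springer (1977), II Prop. 2.5 (the local rings of
  `Proj S`). [Hartshorne1977]
-/

noncomputable section

universe u

open CategoryTheory AlgebraicGeometry Order Topology TopologicalSpace IsLocalRing HomogeneousLocalization
open MvPolynomial (X C)
open Literature.AlgebraicGeometry.Motives.Segre Literature.AlgebraicGeometry.Motives.RatFn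

attribute [local instance] MvPolynomial.gradedAlgebra

namespace Literature.AlgebraicGeometry.Motives

/-! ### Algebra: homogeneous members of an ideal generated by linear forms -/

section Algebra

variable {K : Type u} [Field K] {σ : Type*}

/-- **A form of degree `e ≥ 1` in the ideal of linear forms `L₁, …, L_t` is `Σ Lⱼ Hⱼ` with `Hⱼ` forms
of degree `e - 1`** (take the degree-`e` components of any representation `Σ cⱼ Lⱼ`).
[folklore] -/
theorem exists_eq_sum_mul_of_mem_span_of_isHomogeneous {t : ℕ} (L : Fin t → MvPolynomial σ K)
    (hL : ∀ j, (L j).IsHomogeneous 1) {G : MvPolynomial σ K} (hG : G ∈ Ideal.span (Set.range L))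
    {e : ℕ} (he : 1 ≤ e) (hGe : G.IsHomogeneous e) :
    ∃ H : Fin t → MvPolynomial σ K, (∀ j, (H j).IsHomogeneous (e - 1)) ∧ G = ∑ j, H j * L j := by
  classical
  obtain ⟨c, hc⟩ := Ideal.mem_span_range_iff_exists_fun.mp hG
  refine ⟨fun j => MvPolynomial.homogeneousComponent (e - 1) (c j),
    fun j => MvPolynomial.homogeneousComponent_isHomogeneous _ _, ?_⟩
  have hGc : MvPolynomial.homogeneousComponent e G = G :=
    MvPolynomial.homogeneousComponent_of_mem (n := e) hGe |>.trans (if_pos rfl)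
  rw [← hGc, ← hc, map_sum]
  refine Finset.sum_congr rfl fun j _ => ?_
  -- `(c_j L_j)_e = (c_j)_{e-1} L_j`
  have hdec : ∀ (φ : MvPolynomial σ K) (i : ℕ),
      ((DirectSum.decompose (MvPolynomial.homogeneousSubmodule σ K) φ i : _) : MvPolynomial σ K) =
        MvPolynomial.homogeneousComponent i φ := fun φ i => by
    rw [← DirectSum.Decomposition.decompose'_eq]
    exact MvPolynomial.decomposition.decompose'_apply φ i
  have h := DirectSum.coe_decompose_mul_of_right_mem_of_le
    (𝒜 := MvPolynomial.homogeneousSubmodule σ K) (a := c j)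
    ((MvPolynomial.mem_homogeneousSubmodule 1 (L j)).2 (hL j)) he
  rw [hdec, hdec] at h
  exact h

end Algebra

namespace ProjSpace

variable {d : ℕ} {K : Type u} [Field K]

/-! ### The prime `𝔭_y ∩ Γ(D₊(x_l), 𝒪)` of a point of a standard chart -/

/-- The standard chart `D₊(x_l)` is an affine open. [folklore] -/
theorem isAffineOpen_U (l : Fin (d + 1)) : IsAffineOpen (U (d := d) (K := K) l) :=
  GeneratingSections.isAffineOpen_ofHom_U (𝟙 (P d K)) l

/-- **Membership in the prime of a point of the chart `D₊(x_l)`**: the section of a degree-zero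
fraction `a` lies in the prime `primeIdealOf y ⊆ Γ(D₊(x_l), 𝒪)` iff its rational function is not a
unit at `y`. [folklore] -/
theorem sec_mem_primeIdealOf_iff (l : Fin (d + 1)) {y : P d K} (hy : y ∈ U l)
    (a : Away (grading (Fin (d + 1)) K) (X l)) :
    sec l a ∈ ((isAffineOpen_U l).primeIdealOf ⟨y, hy⟩).asIdeal ↔
      ¬ IsUnitAt y (awayToFunctionField l a) := by
  rw [mem_primeIdealOf_iff, awayToFunctionField_apply, isUnitAt_ofSection_iff hy,
    Scheme.mem_basicOpen _ _ _ hy]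
  exact IsLocalRing.mem_maximalIdeal _

/-- For a form `F` of degree `e ≥ 1`: `sec (F/x_lᵉ) ∈ primeIdealOf y` iff `F ∈ 𝔭_y`. [folklore] -/
theorem sec_mk_mem_primeIdealOf_iff (l : Fin (d + 1)) {y : P d K} (hy : y ∈ U l) {e : ℕ}
    (he : 0 < e) {F : MvPolynomial (Fin (d + 1)) K} (hF : F ∈ grading (Fin (d + 1)) K e) :
    sec l (Away.mk _ (X_mem K l) e F (mem_smul_one hF)) ∈
        ((isAffineOpen_U l).primeIdealOf ⟨y, hy⟩).asIdeal ↔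
      F ∈ y.asHomogeneousIdeal := by
  rw [sec_mem_primeIdealOf_iff l hy, isUnitAt_awayToFunctionField_mk_iff l he hF hy, not_not]

/-- **The prime of a linear-subspace point in a standard chart is generated by its dehomogenised
linear equations**: if the homogeneous prime of `y ∈ D₊(x_l)` is generated (as an ideal) by linear
forms `L₁, …, L_t`, then `primeIdealOf y ⊆ Γ(D₊(x_l), 𝒪) = (K[x]_{(x_l)})₀` is generated by the
sections of `L₁/x_l, …, L_t/x_l` (`𝒪_{ℙ,y} = K[x]_{(𝔭_y)}`, Hartshorne II Prop. 2.5; the degree-`e`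
members of `(L₁, …, L_t)` are `Σ Lⱼ Hⱼ`, `exists_eq_sum_mul_of_mem_span_of_isHomogeneous`).
[folklore] -/
theorem primeIdealOf_eq_span_sec {t : ℕ} (l : Fin (d + 1)) {y : P d K} (hy : y ∈ U l)
    (L : Fin t → MvPolynomial (Fin (d + 1)) K) (hL : ∀ j, (L j).IsHomogeneous 1)
    (hyL : (y.asHomogeneousIdeal).toIdeal = Ideal.span (Set.range L)) :
    ((isAffineOpen_U l).primeIdealOf ⟨y, hy⟩).asIdeal =
      Ideal.span (Set.range fun j => sec l (Away.mk _ (X_mem K l) 1 (L j)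
        (mem_smul_one ((MvPolynomial.mem_homogeneousSubmodule _ _).2 (hL j))))) := by
  apply le_antisymm
  · intro s hs
    -- `s = sec (G/x_lᵉ)`, and we may take `e ≥ 1`
    obtain ⟨b, rfl⟩ := (sec_bijective l).2 s
    obtain ⟨e, G, hG, rfl⟩ := Away.mk_surjective (grading (Fin (d + 1)) K) (X_mem K l) b
    have hG' : G ∈ grading (Fin (d + 1)) K e := by simpa using hG
    have hpad : Away.mk _ (X_mem K l) (e + 1) (G * X l ^ 1) (mem_smul_one (mul_X_pow_mem hG' 1)) =
        Away.mk _ (X_mem K l) e G hG := awayMk_mul_X_pow l hG 1 _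
    rw [← hpad] at hs ⊢
    have hGy : G * X l ^ 1 ∈ y.asHomogeneousIdeal :=
      (sec_mk_mem_primeIdealOf_iff l hy (Nat.succ_pos e) (mul_X_pow_mem hG' 1)).1 hs
    have hGy' : G * X l ^ 1 ∈ Ideal.span (Set.range L) := by
      rw [← hyL]
      exact hGy
    obtain ⟨H, hH, hGH⟩ := exists_eq_sum_mul_of_mem_span_of_isHomogeneous L hL hGy'
      (Nat.succ_le_succ (Nat.zero_le e))
      ((MvPolynomial.mem_homogeneousSubmodule _ _).1 (mul_X_pow_mem hG' 1))
    have hmem : (∑ j, H j * L j) ∈ grading (Fin (d + 1)) K ((e + 1) • 1) := by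
      rw [← hGH]
      exact mem_smul_one (mul_X_pow_mem hG' 1)
    have hrw : Away.mk _ (X_mem K l) (e + 1) (G * X l ^ 1) (mem_smul_one (mul_X_pow_mem hG' 1)) =
        Away.mk _ (X_mem K l) (e + 1) (∑ j, H j * L j) hmem := by
      apply val_injective
      simp only [Away.val_mk, hGH]
    rw [hrw, awayMk_eq_eval₂, map_sum]
    change (secRingHom l) _ ∈ _
    rw [map_sum]
    refine Ideal.sum_mem _ fun j _ => ?_
    rw [map_mul, map_mul]
    refine Ideal.mul_mem_left _ _ ?_
    rw [← awayMk_eq_eval₂ K l 1 (L j) (mem_smul_one ((MvPolynomial.mem_homogeneousSubmodule _ _).2 (hL j)))]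
    exact Ideal.subset_span ⟨j, rfl⟩
  · rw [Ideal.span_le]
    rintro _ ⟨j, rfl⟩
    have hLj : L j ∈ y.asHomogeneousIdeal := by
      change L j ∈ (y.asHomogeneousIdeal).toIdeal
      rw [hyL]
      exact Ideal.subset_span ⟨j, rfl⟩
    exact (sec_mk_mem_primeIdealOf_iff l hy zero_lt_one
      ((MvPolynomial.mem_homogeneousSubmodule _ _).2 (hL j))).2 hLj


/-! ### The local ring at a hyperplane: `ord_{V₊(ℓ)}(ℓ/x_l) = 1` -/

/-- `ℙ^d_K` is locally Noetherian (locally of finite type over a field). [folklore] -/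
instance isLocallyNoetherian_P : IsLocallyNoetherian (P d K) :=
  LocallyOfFiniteType.isLocallyNoetherian ((P d K) ↘ Spec (.of K))

/-- **In the local ring of `ℙ^d` at a linear-subspace point, the germs of the dehomogenised
equations generate the maximal ideal** (`𝒪_{ℙ,y} = (K[x]_{(x_l)})₀` localised at `primeIdealOf y`,
Mathlib `IsAffineOpen.isLocalization_stalk`, `IsLocalization.AtPrime.map_eq_maximalIdeal`).
[folklore] -/
theorem maximalIdeal_stalk_eq_span {t : ℕ} (l : Fin (d + 1)) {y : P d K} (hy : y ∈ U l)
    (L : Fin t → MvPolynomial (Fin (d + 1)) K) (hL : ∀ j, (L j).IsHomogeneous 1)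
    (hyL : (y.asHomogeneousIdeal).toIdeal = Ideal.span (Set.range L)) :
    maximalIdeal ((P d K).presheaf.stalk y) =
      Ideal.span (Set.range fun j => ((P d K).presheaf.germ (U l) y hy).hom
        (sec l (Away.mk _ (X_mem K l) 1 (L j)
          (mem_smul_one ((MvPolynomial.mem_homogeneousSubmodule _ _).2 (hL j)))))) := by
  letI := TopCat.Presheaf.algebra_section_stalk (P d K).presheaf (⟨y, hy⟩ : U (d := d) (K := K) l)
  haveI := (isAffineOpen_U l).isLocalization_stalk ⟨y, hy⟩
  have h := IsLocalization.AtPrime.map_eq_maximalIdeal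
    ((isAffineOpen_U l).primeIdealOf ⟨y, hy⟩).asIdeal ((P d K).presheaf.stalk y)
  rw [primeIdealOf_eq_span_sec l hy L hL hyL, Ideal.map_span, ← Set.range_comp] at h
  exact h.symm

/-- The rational function `F/x_lᵉ` is the image in `K(ℙ^d)` of the germ at `y ∈ D₊(x_l)` of its
section. [folklore] -/
theorem toFunctionField_germ_sec (l : Fin (d + 1)) {y : P d K} (hy : y ∈ U l)
    (a : Away (grading (Fin (d + 1)) K) (X l)) :
    toFunctionField y (((P d K).presheaf.germ (U l) y hy).hom (sec l a)) = awayToFunctionField l a := by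
  rw [awayToFunctionField_apply]
  exact toFunctionField_germ hy (sec l a)

/-- **`ord_{V₊(ℓ)}(ℓ/x_l) = 1`**: at the generic point `η` of a hyperplane `V₊(ℓ)` (homogeneous prime
`(ℓ)`, codimension one) lying in the chart `D₊(x_l)`, the local equation `ℓ/x_l` of `V₊(ℓ)`
generates the maximal ideal of the discrete valuation ring `𝒪_{ℙ^d, η}`, so its order of vanishing is
`ℓ(𝒪/𝔪) = 1` (Fulton, §1.2: `ord_V(r) = ℓ_A(A/(r))`; Example 2.5.1). [cite: Fulton1998, §1.2 and Example 2.5.1] -/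
theorem ord_formToFunctionField_eq_one {ℓ : MvPolynomial (Fin (d + 1)) K}
    (hℓ : ℓ ∈ grading (Fin (d + 1)) K 1) (hℓ0 : ℓ ≠ 0) {η : P d K}
    (hη : (η.asHomogeneousIdeal).toIdeal = Ideal.span {ℓ}) (hcoh : coheight η = 1)
    {l : Fin (d + 1)} (hl : η ∈ U l) :
    Scheme.ord (formToFunctionField l ℓ) η = 1 := by
  set a : Away (grading (Fin (d + 1)) K) (X l) := Away.mk _ (X_mem K l) 1 ℓ (mem_smul_one hℓ) with ha
  set r := ((P d K).presheaf.germ (U l) η hl).hom (sec l a) with hr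
  -- `𝔪_η = (r)`
  have hmax : maximalIdeal ((P d K).presheaf.stalk η) = Ideal.span {r} := by
    have h := maximalIdeal_stalk_eq_span l hl (fun _ : Fin 1 => ℓ)
      (fun _ => (MvPolynomial.mem_homogeneousSubmodule 1 ℓ).1 hℓ) (by rw [Set.range_const]; exact hη)
    rw [h, Set.range_const]
  -- `r ≠ 0` (its rational function is `ℓ/x_l ≠ 0`)
  have hfr : toFunctionField η r = formToFunctionField l ℓ := by
    rw [hr, toFunctionField_germ_sec, formToFunctionField_of_mem l (mem_smul_one hℓ)]
  have hr0 : r ≠ 0 := by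
    intro h0
    apply formToFunctionField_ne_zero l hℓ hℓ0
    rw [← hfr, h0, map_zero]
  -- `Ring.ord 𝒪_η r = ℓ(𝒪_η/𝔪) = 1`
  haveI : Ring.KrullDimLE 1 ((P d K).presheaf.stalk η) := krullDimLE_of_coheight_le hcoh.le
  have hord1 : Ring.ord ((P d K).presheaf.stalk η) r = 1 := by
    rw [Ring.ord, ← hmax]
    haveI : IsSimpleModule ((P d K).presheaf.stalk η)
        (((P d K).presheaf.stalk η) ⧸ maximalIdeal ((P d K).presheaf.stalk η)) :=
      isSimpleModule_iff_quot_maximal.mpr ⟨_, maximalIdeal.isMaximal _, ⟨LinearEquiv.refl _ _⟩⟩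
    exact Module.length_eq_one _ _
  rw [← hfr, Scheme.ord_toFunctionField_eq_toNat hcoh hr0, hord1]
  rfl

/-- **The generic point of a hyperplane `V₊(ℓ) ⊆ ℙ^d`** (`d ≥ 1`): a point with homogeneous prime
`(ℓ)`, of dimension `d - 1` and codimension `1` (`exists_point_of_linearIndependent` for the single
linear form `ℓ`). [folklore] -/
theorem exists_hyperplanePoint (hd : 1 ≤ d) {ℓ : MvPolynomial (Fin (d + 1)) K}
    (hℓ : ℓ ∈ grading (Fin (d + 1)) K 1) (hℓ0 : ℓ ≠ 0) :
    ∃ η : P d K, (η.asHomogeneousIdeal).toIdeal = Ideal.span {ℓ} ∧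
      height η = ((d - 1 : ℕ) : ℕ∞) ∧ coheight η = 1 := by
  have hlin : LinearIndependent K (fun _ : Fin 1 => ℓ) := linearIndependent_unique_iff.2 hℓ0
  obtain ⟨η, hη, hht, hcoh⟩ := exists_point_of_linearIndependent (N := d) (fun _ : Fin 1 => ℓ) hlin
    (fun _ => (MvPolynomial.mem_homogeneousSubmodule 1 ℓ).1 hℓ) hd
  refine ⟨η, ?_, hht, by exact_mod_cast hcoh⟩
  rw [hη, Set.range_const]

/-- The order of the hypersurface divisor `V₊(ℓ)` at the generic point of the hyperplane is `1`.
[cite: Fulton1998, Example 2.5.1] -/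
theorem ordAt_formDivisor_eq_one {ℓ : MvPolynomial (Fin (d + 1)) K}
    (hℓ : ℓ ∈ grading (Fin (d + 1)) K 1) (hℓ0 : ℓ ≠ 0) {η : P d K}
    (hη : (η.asHomogeneousIdeal).toIdeal = Ideal.span {ℓ}) (hcoh : coheight η = 1) :
    (formDivisor ℓ hℓ hℓ0).ordAt η = 1 := by
  obtain ⟨i, hi⟩ := (hyperplane d K).covers η
  rw [hyperplane_U] at hi
  have hi' : η ∈ (formDivisor ℓ hℓ hℓ0).U (i, PUnit.unit) := (mem_formDivisor_U_iff hℓ hℓ0 _).2 hi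
  rw [(formDivisor ℓ hℓ hℓ0).ordAt_eq_ord hi', formDivisor_f]
  exact ord_formToFunctionField_eq_one hℓ hℓ0 hη hcoh hi

/-- On `ℙ^d`, the specialisation `η ⤳ y` holds iff `𝔭_η ≤ 𝔭_y`. [folklore] -/
theorem specializes_iff_le {a b : P d K} :
    a ⤳ b ↔ (a.asHomogeneousIdeal).toIdeal ≤ (b.asHomogeneousIdeal).toIdeal := by
  rw [← Scheme.le_iff_specializes]
  exact projectiveSpace_le_iff (N := d) (k := K)

/-- **The Weil divisor of the hyperplane `V₊(ℓ)` is the prime cycle of its generic point, with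
multiplicity one**: `[V₊(ℓ)] = 1 · [η_ℓ]` (Fulton, Example 2.5.1 / §2.1: the associated Weil divisor
of the effective Cartier divisor `V₊(ℓ)`). [cite: Fulton1998, §2.1 and Example 2.5.1] -/
theorem cycle_formDivisor_eq_primeCycle {ℓ : MvPolynomial (Fin (d + 1)) K}
    (hℓ : ℓ ∈ grading (Fin (d + 1)) K 1) (hℓ0 : ℓ ≠ 0) {η : P d K}
    (hη : (η.asHomogeneousIdeal).toIdeal = Ideal.span {ℓ}) (hcoh : coheight η = 1) :
    (formDivisor ℓ hℓ hℓ0).cycle = primeCycle η := by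
  ext y
  rw [CartierDivisor.cycle_apply]
  by_cases hyη : y = η
  · subst hyη
    rw [primeCycle_apply_self]
    exact ordAt_formDivisor_eq_one hℓ hℓ0 hη hcoh
  rw [primeCycle_apply_of_ne hyη]
  by_cases hy1 : coheight y = 1
  · by_cases hℓy : ℓ ∈ y.asHomogeneousIdeal
    · -- `η ⤳ y` with both of codimension one forces `y = η`
      exfalso
      have hηy : η ⤳ y := by
        rw [specializes_iff_le, hη, Ideal.span_singleton_le_iff_mem]
        exact hℓy
      have hle : y ≤ η := Scheme.le_iff_specializes.mpr hηy
      have hlt : y < η := lt_of_le_not_ge hle fun hge =>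
        hyη (hηy.antisymm (Scheme.le_iff_specializes.mp hge)).eq.symm
      have h1 := height_add_one_le hlt
      have hsy := Scheme.height_add_coheight_eq_height_top ((P d K) ↘ Spec (.of K)) y
      have hsη := Scheme.height_add_coheight_eq_height_top ((P d K) ↘ Spec (.of K)) η
      rw [hy1] at hsy
      rw [hcoh] at hsη
      obtain ⟨a, ha⟩ := ENat.ne_top_iff_exists.mp
        (height_ne_top_of_locallyOfFiniteType ((P d K) ↘ Spec (.of K)) η)
      rw [← ha] at h1 hsη
      rw [← hsη] at hsy
      have heq : height y = (a : ℕ∞) := WithTop.add_right_cancel WithTop.one_ne_top hsy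
      rw [heq] at h1
      exact absurd h1 (by norm_cast; omega)
    · exact CartierDivisor.Avoids.ordAt_eq_zero ((formDivisor_avoids_iff hℓ hℓ0 zero_lt_one).2 hℓy)
  · obtain ⟨j, hj⟩ := (formDivisor ℓ hℓ hℓ0).covers y
    rw [(formDivisor ℓ hℓ hℓ0).ordAt_eq_ord hj]
    exact Scheme.ord_eq_zero_of_coheight_neq_one hy1 _


/-! ### Hyperplane sections of linear subspaces have multiplicity one -/

/-- **Local algebra of a hyperplane section of a linear subspace.** Let `w ⤳ w'` be linear-subspace
points of `ℙ^d` with homogeneous primes `(L)` and `(L')`, `L' ⊆ L ∪ {ℓ}` and `ℓ ∈ L'` (so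
`closure {w'} = closure {w} ∩ V₊(ℓ)`), both in the chart `D₊(x_l)`. In `A = 𝒪_{ℙ,w'}` let `𝔭` be the
prime of the generisation `w` and `t` the germ of `ℓ/x_l`. Then `𝔭 + (t) = 𝔪_A`, so the order of `t̄`
in the one-dimensional local ring `A/𝔭` (the local ring of `closure {w}` at `w'`) is
`ℓ_{A/𝔭}((A/𝔭)/(t̄)) = ℓ(A/𝔪) = 1` (Fulton, Thm. 2.4 Case 1: "the coefficient of `[W]` in `D · [V]` is
`ℓ_{A/p}(A/p + aA)`"; Example 2.5.1). [cite: Fulton1998, Example 2.5.1] -/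
theorem ord_quotient_germ_eq_one {tL tL' : ℕ} (l : Fin (d + 1)) {w w' : P d K} (hww' : w ⤳ w')
    (hl' : w' ∈ U l) (L : Fin tL → MvPolynomial (Fin (d + 1)) K)
    (hwL : (w.asHomogeneousIdeal).toIdeal = Ideal.span (Set.range L))
    {ℓ : MvPolynomial (Fin (d + 1)) K} (hℓ : ℓ ∈ grading (Fin (d + 1)) K 1)
    (L' : Fin tL' → MvPolynomial (Fin (d + 1)) K) (hL' : ∀ j, (L' j).IsHomogeneous 1)
    (hw'L' : (w'.asHomogeneousIdeal).toIdeal = Ideal.span (Set.range L'))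
    (hsub : Set.range L' ⊆ insert ℓ (Set.range L)) (hℓL' : ℓ ∈ Set.range L') :
    Ring.ord ((P d K).presheaf.stalk w' ⧸ (maximalIdeal ((P d K).presheaf.stalk w)).comap
        ((P d K).presheaf.stalkSpecializes hww').hom)
      (Ideal.Quotient.mk _ (((P d K).presheaf.germ (U l) w' hl').hom
        (sec l (Away.mk _ (X_mem K l) 1 ℓ (mem_smul_one hℓ))))) = 1 := by
  set O := (P d K).presheaf.stalk w' with hO
  set 𝔭 : Ideal O := (maximalIdeal ((P d K).presheaf.stalk w)).comap
    ((P d K).presheaf.stalkSpecializes hww').hom with h𝔭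
  set t : O := ((P d K).presheaf.germ (U l) w' hl').hom (sec l (Away.mk _ (X_mem K l) 1 ℓ (mem_smul_one hℓ)))
    with ht
  have hwl : w ∈ U l := hww'.mem_open (U l).2 hl'
  have h𝔭top : 𝔭 ≠ ⊤ := (inferInstance : 𝔭.IsPrime).ne_top
  haveI : Nontrivial (O ⧸ 𝔭) := Ideal.Quotient.nontrivial_iff.mpr h𝔭top
  haveI : IsLocalRing (O ⧸ 𝔭) := IsLocalRing.of_surjective' (Ideal.Quotient.mk 𝔭) Ideal.Quotient.mk_surjective
  haveI := IsLocalHom.of_surjective (Ideal.Quotient.mk 𝔭) Ideal.Quotient.mk_surjective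
  have hmax : (maximalIdeal O).map (Ideal.Quotient.mk 𝔭) = maximalIdeal (O ⧸ 𝔭) := by
    ext x
    obtain ⟨x, rfl⟩ := Ideal.Quotient.mk_surjective x
    simp [sup_eq_left.mpr (le_maximalIdeal h𝔭top)]
  -- the germs of `L_i/x_l` lie in `𝔭`
  have hgermL : ∀ {G : MvPolynomial (Fin (d + 1)) K} (hG : G ∈ grading (Fin (d + 1)) K 1),
      G ∈ w.asHomogeneousIdeal →
        ((P d K).presheaf.germ (U l) w' hl').hom (sec l (Away.mk _ (X_mem K l) 1 G (mem_smul_one hG))) ∈ 𝔭 := by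
    intro G hG hGw
    rw [h𝔭, Ideal.mem_comap, ← CommRingCat.comp_apply, (P d K).presheaf.germ_stalkSpecializes hl' hww',
      ← mem_primeIdealOf_iff (isAffineOpen_U l) ⟨w, hwl⟩]
    exact (sec_mk_mem_primeIdealOf_iff l hwl zero_lt_one hG).2 hGw
  -- `(t̄) = 𝔪_{A/𝔭}`
  have hspan : Ideal.span {Ideal.Quotient.mk 𝔭 t} = maximalIdeal (O ⧸ 𝔭) := by
    rw [← hmax, show maximalIdeal O = _ from maximalIdeal_stalk_eq_span l hl' L' hL' hw'L', Ideal.map_span]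
    -- the germ of `L'_j/x_l` for `L' j = ℓ` is `t`
    have hgen : ∀ j, L' j = ℓ → ((P d K).presheaf.germ (U l) w' hl').hom (sec l (Away.mk _ (X_mem K l) 1 (L' j)
        (mem_smul_one ((MvPolynomial.mem_homogeneousSubmodule _ _).2 (hL' j))))) = t := by
      intro j hj
      rw [ht]
      have : Away.mk (grading (Fin (d + 1)) K) (X_mem K l) 1 (L' j)
          (mem_smul_one ((MvPolynomial.mem_homogeneousSubmodule _ _).2 (hL' j))) =
          Away.mk _ (X_mem K l) 1 ℓ (mem_smul_one hℓ) := by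
        apply val_injective
        simp only [Away.val_mk, hj]
      rw [this]
    apply le_antisymm
    · rw [Ideal.span_le, Set.singleton_subset_iff]
      obtain ⟨j, hj⟩ := hℓL'
      refine Ideal.subset_span ⟨_, ⟨j, rfl⟩, ?_⟩
      change Ideal.Quotient.mk 𝔭 (((P d K).presheaf.germ (U l) w' hl').hom (sec l (Away.mk _ (X_mem K l) 1 (L' j)
        (mem_smul_one ((MvPolynomial.mem_homogeneousSubmodule _ _).2 (hL' j)))))) = _
      rw [hgen j hj]
    · rw [Ideal.span_le]
      rintro _ ⟨_, ⟨j, rfl⟩, rfl⟩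
      change Ideal.Quotient.mk 𝔭 (((P d K).presheaf.germ (U l) w' hl').hom (sec l (Away.mk _ (X_mem K l) 1 (L' j)
        (mem_smul_one ((MvPolynomial.mem_homogeneousSubmodule _ _).2 (hL' j)))))) ∈ _
      rcases hsub ⟨j, rfl⟩ with hj | ⟨i, hi⟩
      · -- `L' j = ℓ`: the generator is `t̄`
        rw [hgen j hj]
        exact Ideal.mem_span_singleton_self _
      · -- `L' j = L i`: the generator vanishes in `A/𝔭`
        have hmem : L' j ∈ w.asHomogeneousIdeal := by
          change L' j ∈ (w.asHomogeneousIdeal).toIdeal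
          rw [hwL, ← hi]
          exact Ideal.subset_span ⟨i, rfl⟩
        rw [Ideal.Quotient.eq_zero_iff_mem.2
          (hgermL ((MvPolynomial.mem_homogeneousSubmodule _ _).2 (hL' j)) hmem)]
        exact zero_mem _
  rw [Ring.ord, hspan]
  haveI : IsSimpleModule (O ⧸ 𝔭) ((O ⧸ 𝔭) ⧸ maximalIdeal (O ⧸ 𝔭)) :=
    isSimpleModule_iff_quot_maximal.mpr ⟨_, maximalIdeal.isMaximal _, ⟨LinearEquiv.refl _ _⟩⟩
  exact Module.length_eq_one _ _

/-- **A hyperplane section of an `r`-plane is an `(r-1)`-plane, with multiplicity one**: for an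
`r`-plane point `w` of `ℙᴺ_K` (`1 ≤ r`) and a linear form `ℓ ∉ 𝔭_w`,
`V₊(ℓ) · [closure {w}] = [closure {w'}]` for the `(r-1)`-plane point `w'` of `closure {w} ∩ V₊(ℓ)`
(Fulton, Example 2.5.1: `c₁(𝒪(1)) ∩ [Lᵏ] = [Lᵏ⁻¹]`). Sharpens
`exists_primeInter_formDivisor_eq_smul_of_isLinearSubspacePoint` (`a • [closure {w'}]`, `a ≥ 1`) by
the local computation `ord_quotient_germ_eq_one`. [cite: Fulton1998, Example 2.5.1 (p. 41)] -/
theorem exists_primeInter_formDivisor_eq_primeCycle_of_isLinearSubspacePoint {N : ℕ} {r : ℕ}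
    (hr : 1 ≤ r) {w : ↥(projectiveSpace N K).left}
    (hw : IsLinearSubspacePoint r N (𝟙 (projectiveSpace N K)) w)
    {ℓ : MvPolynomial (Fin (N + 1)) K} (hℓ : ℓ ∈ grading (Fin (N + 1)) K 1) (hℓ0 : ℓ ≠ 0)
    (hℓw : ℓ ∉ (ProjectiveSpectrum.asHomogeneousIdeal
      (𝒜 := MvPolynomial.homogeneousSubmodule (Fin (N + 1)) K) w)) :
    ∃ w' : ↥(projectiveSpace N K).left, IsLinearSubspacePoint (r - 1) N (𝟙 (projectiveSpace N K)) w' ∧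
      (formDivisor ℓ hℓ hℓ0).primeInter (X := projectiveSpace N K) w = primeCycle w' := by
  classical
  obtain ⟨w', a, hw', ha, hprime⟩ :=
    exists_primeInter_formDivisor_eq_smul_of_isLinearSubspacePoint hr hw hℓ hℓ0 hℓw
  refine ⟨w', hw', ?_⟩
  set H' : CartierDivisor (projectiveSpace N K).left := formDivisor ℓ hℓ hℓ0 with hH'
  have hcoef : H'.primeInter (X := projectiveSpace N K) w w' = a := by
    rw [hprime, Function.locallyFinsuppWithin.coe_zsmul, Pi.smul_apply, primeCycle_apply_self, smul_eq_mul,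
      mul_one]
  suffices h1 : H'.primeInter (X := projectiveSpace N K) w w' = 1 by
    rw [hprime, ← hcoef, h1, one_smul]
  -- equations of `w` and `w'`
  obtain ⟨L, hL, hhom, hcl, hspan, hrN⟩ := hw.exists_eq_span_of_id
  have hht : height w = r := hw.1
  have hne : H'.primeInter (X := projectiveSpace N K) w w' ≠ 0 := by
    rw [hcoef]
    exact ha.ne'
  have hww' : w ⤳ w' := H'.specializes_of_primeInter_ne_zero hne
  have hℓw' : ℓ ∈ ProjectiveSpectrum.asHomogeneousIdeal
      (𝒜 := MvPolynomial.homogeneousSubmodule (Fin (N + 1)) K) w' := by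
    by_contra h
    exact H'.not_avoids_of_primeInter_ne_zero hne ((formDivisor_avoids_iff hℓ hℓ0 zero_lt_one).2 h)
  -- the explicit point `w''` of `V₊(L, ℓ)` and `w' = w''`
  have hℓspan : ℓ ∉ Submodule.span K (Set.range L) := by
    intro h
    apply hℓw
    have h' : ℓ ∈ Ideal.span (Set.range L) := by
      have hle : Submodule.span K (Set.range L) ≤ (Ideal.span (Set.range L)).restrictScalars K :=
        Submodule.span_le.mpr Ideal.subset_span
      exact hle h
    change ℓ ∈ (ProjectiveSpectrum.asHomogeneousIdeal
      (𝒜 := MvPolynomial.homogeneousSubmodule (Fin (N + 1)) K) w).toIdeal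
    rw [hspan]
    exact h'
  set L' : Fin (N - r + 1) → MvPolynomial (Fin (N + 1)) K := Fin.snoc L ℓ with hL'
  have hL'ind : LinearIndependent K L' := linearIndependent_finSnoc.2 ⟨hL, hℓspan⟩
  have hL'hom : ∀ j, (L' j).IsHomogeneous 1 := by
    intro j
    refine Fin.lastCases ?_ (fun i => ?_) j
    · rw [hL', Fin.snoc_last]
      exact (MvPolynomial.mem_homogeneousSubmodule 1 ℓ).1 hℓ
    · rw [hL', Fin.snoc_castSucc]
      exact hhom i
  have hrange : Set.range L' = insert ℓ (Set.range L) := by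
    ext g
    simp only [Set.mem_range, Set.mem_insert_iff]
    constructor
    · rintro ⟨j, rfl⟩
      refine Fin.lastCases ?_ (fun i => ?_) j
      · left; rw [hL', Fin.snoc_last]
      · right; exact ⟨i, by rw [hL', Fin.snoc_castSucc]⟩
    · rintro (rfl | ⟨i, rfl⟩)
      · exact ⟨Fin.last _, by rw [hL', Fin.snoc_last]⟩
      · exact ⟨Fin.castSucc i, by rw [hL', Fin.snoc_castSucc]⟩
  obtain ⟨w'', hw''span, hhtw'', -⟩ :=
    exists_point_of_linearIndependent L' hL'ind hL'hom (by omega)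
  have hhtw''2 : height w'' = ((r - 1 : ℕ) : ℕ∞) := by
    rw [hhtw'']
    congr 1
    omega
  have hsetw'' : ((ProjectiveSpectrum.asHomogeneousIdeal
      (𝒜 := MvPolynomial.homogeneousSubmodule (Fin (N + 1)) K) w'' :
        HomogeneousIdeal (MvPolynomial.homogeneousSubmodule (Fin (N + 1)) K)) :
          Set (MvPolynomial (Fin (N + 1)) K)) =
      (Ideal.span (Set.range L') : Set (MvPolynomial (Fin (N + 1)) K)) := by
    rw [← hw''span]
    rfl
  have hclw'' : closure {w''} = closure {w} ∩ ProjectiveSpectrum.zeroLocus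
      (MvPolynomial.homogeneousSubmodule (Fin (N + 1)) K) {ℓ} := by
    rw [closure_singleton_eq_zeroLocus, hsetw'', ProjectiveSpectrum.zeroLocus_span, hcl, hrange,
      Set.insert_eq, ProjectiveSpectrum.zeroLocus_union]
    exact Set.inter_comm _ _
  have heqw : w' = w'' := by
    have hmem : w' ∈ closure {w''} := by
      rw [hclw'']
      exact ⟨hww'.mem_closure,
        (ProjectiveSpectrum.mem_zeroLocus _ _ _).2 (Set.singleton_subset_iff.2 hℓw')⟩
    have hspec : w'' ⤳ w' := specializes_iff_mem_closure.2 (by simpa using hmem)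
    have hle : w' ≤ w'' := Scheme.le_iff_specializes.mpr hspec
    by_contra hneq
    have hlt : w' < w'' := lt_of_le_not_ge hle fun hge =>
      hneq ((hspec.antisymm (Scheme.le_iff_specializes.mp hge)).eq.symm)
    have h1 := height_add_one_le hlt
    rw [hw'.1, hhtw''2] at h1
    exact absurd h1 (by norm_cast; omega)
  subst heqw
  -- the coefficient at `w'` through the local formula
  have hH'w : H'.Avoids w := (formDivisor_avoids_iff hℓ hℓ0 zero_lt_one).2 hℓw
  have hH'gen : H'.Avoids ((ClosedSubvariety.ofPoint (projectiveSpace N K).left w).ι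
      (genericPoint (ClosedSubvariety.ofPoint (projectiveSpace N K).left w).carrier)) := by
    change H'.Avoids (ClosedSubvariety.ofPoint (projectiveSpace N K).left w).genericPoint
    rw [ClosedSubvariety.genericPoint_ofPoint]
    exact hH'w
  rw [H'.primeInter_apply_of_specializes hww', CartierDivisor.pullbackRep_of_avoids _ _ hH'gen]
  -- a chart `D₊(x_l) ∋ w'` and the local equation `ℓ/x_l`
  obtain ⟨i, hi⟩ := (hyperplane N K).covers w'
  rw [hyperplane_U] at hi
  set l := i.down.1 with hl_def
  have hi' : w' ∈ H'.U (i, PUnit.unit) := (mem_formDivisor_U_iff hℓ hℓ0 _).2 hi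
  set tt := (((projectiveSpace N K).left).presheaf.germ (U l) w' hi).hom
    (sec l (Away.mk _ (X_mem K l) 1 ℓ (mem_smul_one hℓ))) with htt
  have htf : toFunctionField w' tt = H'.f (i, PUnit.unit) := by
    rw [show H'.f (i, PUnit.unit) = formToFunctionField l ℓ from formDivisor_f hℓ hℓ0 (i, PUnit.unit), htt]
    exact (toFunctionField_germ_sec l hi _).trans (formToFunctionField_of_mem l (mem_smul_one hℓ)).symm
  -- `codim_{closure {w}} w' = 1`
  have hcoh : coheight (ClosedSubvariety.ofPointPt w hww') = 1 := by
    set V := ClosedSubvariety.ofPoint (projectiveSpace N K).left w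
    have hsum := Scheme.height_add_coheight_eq_height_top (V.over (projectiveSpace N K).hom).hom
      (ClosedSubvariety.ofPointPt w hww')
    change height (ClosedSubvariety.ofPointPt w hww') + coheight (ClosedSubvariety.ofPointPt w hww') =
      height (⊤ : ↥V.carrier) at hsum
    rw [height_top_ofPoint, hht, ← height_base_eq_of_isClosedImmersion' V.ι] at hsum
    change height w' + _ = _ at hsum
    rw [hw'.1] at hsum
    have h1 : ((r - 1 : ℕ) : ℕ∞) + 1 = (r : ℕ∞) := by norm_cast; omega
    rw [← h1] at hsum
    exact WithTop.add_left_cancel (ENat.coe_ne_top _) hsum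
  -- `t ∉ 𝔭` (`ℓ ∉ 𝔭_w`)
  have hwl : w ∈ U l := hww'.mem_open (U l).2 hi
  have htz : tt ∉ (maximalIdeal (((projectiveSpace N K).left).presheaf.stalk w)).comap
      (((projectiveSpace N K).left).presheaf.stalkSpecializes hww').hom := by
    rw [Ideal.mem_comap, htt, ← CommRingCat.comp_apply,
      ((projectiveSpace N K).left).presheaf.germ_stalkSpecializes hi hww']
    exact fun h => hℓw ((sec_mk_mem_primeIdealOf_iff l hwl zero_lt_one hℓ).1
      ((mem_primeIdealOf_iff (isAffineOpen_U l) ⟨w, hwl⟩ _).2 h))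
  have hord := ord_quotient_germ_eq_one l hww' hi L hspan hℓ L' hL'hom hw''span (hrange ▸ le_rfl)
    ⟨Fin.last _, by rw [hL', Fin.snoc_last]⟩
  rw [CartierDivisor.ordAt_pullbackAvoiding_ofPoint_eq_toNat_ord_quotient hww' hi' htf hH'gen hcoh htz]
  erw [hord]
  rfl


/-- **`c₁(𝒪(1)) ∩ [Lⁿ⁺¹] = [Lⁿ]` in `CH_n(ℙᴺ_K)`** (Fulton, Example 2.5.1: "If `Lᵏ` is a
`k`-dimensional linear subspace of `ℙⁿ`, then `c₁(𝒪(1)) ∩ [Lᵏ] = [Lᵏ⁻¹]`"; `K` infinite, for the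
tree's `hyperplaneSection`): the hyperplane section of the class of an `(n+1)`-plane is the class of an
`n`-plane, with multiplicity one. [cite: Fulton1998, Example 2.5.1 (p. 41)] -/
theorem exists_hyperplaneSection_mk_primeCycle_eq [Infinite K] {N n : ℕ}
    {w : ↥(projectiveSpace N K).left} (hw : IsLinearSubspacePoint (n + 1) N (𝟙 (projectiveSpace N K)) w) :
    ∃ (w' : ↥(projectiveSpace N K).left) (hw' : IsLinearSubspacePoint n N (𝟙 (projectiveSpace N K)) w'),
      hyperplaneSection N K n (ChowGroup.mk (projectiveSpace N K).left (n + 1)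
          ⟨primeCycle w, primeCycle_mem_cyclesOfDim hw.1⟩) =
        ChowGroup.mk (projectiveSpace N K).left n ⟨primeCycle w', primeCycle_mem_cyclesOfDim hw'.1⟩ := by
  -- a coordinate hyperplane `V₊(x_l) ∌ w`
  obtain ⟨l, hl⟩ := exists_X_notMem w
  obtain ⟨w', hw', hinter⟩ := exists_primeInter_formDivisor_eq_primeCycle_of_isLinearSubspacePoint
    (Nat.succ_le_succ (Nat.zero_le n)) hw (X_mem K l) (MvPolynomial.X_ne_zero l) hl
  rw [Nat.succ_sub_one] at hw'
  refine ⟨w', hw', ?_⟩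
  rw [hyperplaneSection_mk, ChowGroup.mk_eq_mk_iff]
  change (hyperplane N K).interCycle (X := projectiveSpace N K) (primeCycle w) - primeCycle w' ∈
    ratTrivial (projectiveSpace N K).left n
  rw [← hinter, ← CartierDivisor.interCycle_primeCycle]
  exact ratTrivialOn_le_ratTrivial
    ((hyperplane_linEquiv_formDivisor (X_mem K l) (MvPolynomial.X_ne_zero l)).interCycle_sub_interCycle_mem
      (X := projectiveSpace N K) (primeCycle_mem_cyclesOfDim hw.1)
      (finite_support_of_compactSpace (Y := (projectiveSpace N K).left) (primeCycle w)))

end ProjSpace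

end Literature.AlgebraicGeometry.Motives

end
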